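import Mathlib
import HarnessLib
import Literature.NumberTheory.LFunctions.HallTenenbaumTheorem01
import Literature.NumberTheory.LFunctions.MertensElementary
import Literature.NumberTheory.LFunctions.MertensTail
import Summits.Parity.BatemanHorn.Theorems.AlmostPrimeZerosSystemZeroRepulsionRoughMomentProduct

/-!
# Real-axis, linear-system slice of the rough majorant S6 (line `smooth-rough-lattice-acquisition`)

Crux `AlmostPrimeZeros.SystemZeroRepulsion` (stmt-Parity-11291).  Stub S6 `stub_roughMajorant` asks, for every
Bateman–Horn system, `‖Σ_{m₀≤n≤x} z^{s♯_x(n)}‖ ≤ A·x·U^{k(Re z−1)}·exp(C‖z−1‖log(‖z−1‖+2))` on `‖z−1‖ ≤ 3 log log x`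
(`s♯_x` = capped count of prime factors `> log log x` of the values, `U = log x/log log log x`); its content off the
real axis is parity (rough Chowla along `f`).  Here: the REAL-AXIS slice for `f = (X)` — a sharp exponential moment
`Σ_{n≤x} t^{s♯_x(n)} ≤ A₀·x·U^{t−1}·e^{30t}` (`x ≥ exp(exp 2)`, `1 ≤ t ≤ 1 + 3 log log x`), from the companion file's
Theorem-01 bound by two-sided Mertens (`MertensBound.sum_inv_prime_le`, `MertensBound.loglog_sub_loglog_le_sum_inv_prime`):
`(x/log x)·∏_p F_p ≤ x·U^{t−1}·e^{28t+2}`; and the literal `k = 1`, `f = ![X]`, `z = t` instance of S6's inequality.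
Rankin's trick alone would lose a factor `U`.  Reference: Hall–Tenenbaum, *Divisors* (1988), Thm 01 and (0.4).
-/

noncomputable section

open Finset Real

namespace Summit.Parity.BatemanHorn.Cruxes.SystemZeroRepulsion.SmoothRoughLatticeAcquisition

/-- Numerics: `log log 2 ≤ 0` and `6 / log 2 ≤ 9`. -/
private theorem loglog_two_bounds : Real.log (Real.log 2) ≤ 0 ∧ 6 / Real.log 2 ≤ 9 := by
  have h2 : (0.6931471803 : ℝ) < Real.log 2 := Real.log_two_gt_d9
  have hpos : 0 < Real.log 2 := by linarith
  constructor
  · have h3 : Real.log 2 ≤ 1 := by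
      have := Real.log_two_lt_d9; linarith
    exact Real.log_nonpos hpos.le h3
  · rw [div_le_iff₀ hpos]; linarith

/-- Numerical facts about the scales at `x ≥ exp(exp 2)`: with `ℓ = log x`, `L = log ℓ`, `L₃ = log L`:
`exp 2 ≤ ℓ`, `2 ≤ L`, `0 < L₃`, `ℓ = exp L`, `L ≤ x` and `L₃ ≤ ℓ`. -/
private theorem scales {x : ℕ} (hx : Real.exp (Real.exp 2) ≤ x) :
    Real.exp 2 ≤ Real.log x ∧ 2 ≤ Real.log (Real.log x) ∧ 0 < Real.log (Real.log (Real.log x)) ∧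
      Real.exp (Real.log (Real.log x)) = Real.log x ∧ Real.log (Real.log x) ≤ x ∧
      Real.log (Real.log (Real.log x)) ≤ Real.log x := by
  have hee : 0 < Real.exp (Real.exp 2) := Real.exp_pos _
  have hx0 : (0 : ℝ) < x := lt_of_lt_of_le hee hx
  have hℓ : Real.exp 2 ≤ Real.log x := by
    rw [Real.le_log_iff_exp_le hx0]; exact hx
  have he2 : (2 : ℝ) < Real.exp 2 := by
    have := Real.add_one_le_exp (2 : ℝ); linarith
  have hℓ0 : 0 < Real.log x := by linarith
  have hL : 2 ≤ Real.log (Real.log x) := by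
    rw [Real.le_log_iff_exp_le hℓ0]; exact hℓ
  have hL0 : 0 < Real.log (Real.log x) := by linarith
  have hL3 : 0 < Real.log (Real.log (Real.log x)) := Real.log_pos (by linarith)
  refine ⟨hℓ, hL, hL3, Real.exp_log hℓ0, ?_, ?_⟩
  · have h1 : Real.log (Real.log x) ≤ Real.log x := by
      have := Real.log_le_sub_one_of_pos hℓ0; linarith
    have h2 : Real.log x ≤ x := by
      have := Real.log_le_sub_one_of_pos hx0; linarith
    linarith
  · have h1 : Real.log (Real.log (Real.log x)) ≤ Real.log (Real.log x) := by
      have := Real.log_le_sub_one_of_pos hL0; linarith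
    have h2 : Real.log (Real.log x) ≤ Real.log x := by
      have := Real.log_le_sub_one_of_pos hℓ0; linarith
    linarith

/-- **The Euler product, evaluated** (two-sided Mertens): for `x ≥ exp(exp 2)`, `1 ≤ t ≤ 1 + 3 log log x`,
`(x/log x) ∏_{p ≤ x} exp(a_p/p + 2a_p²/p²) ≤ x · U^{t−1} · exp(28 t + 2)` where `a_p = t` for
`p > log log x`, `a_p = 1` otherwise, and `U = log x / log log log x`. -/
private theorem prod_exp_le {x : ℕ} (hx : Real.exp (Real.exp 2) ≤ x) {t : ℝ} (ht : 1 ≤ t)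
    (htL : t ≤ 1 + 3 * Real.log (Real.log x)) :
    ((x : ℝ) / Real.log x) * ∏ p ∈ Nat.primesLE x,
        Real.exp ((if Real.log (Real.log x) < (p : ℝ) then t else 1) / p +
          2 * (if Real.log (Real.log x) < (p : ℝ) then t else 1) ^ 2 / (p : ℝ) ^ 2) ≤
      (x : ℝ) * (Real.log x / Real.log (Real.log (Real.log x))) ^ (t - 1) * Real.exp (28 * t + 2) := by
  obtain ⟨hℓ, hL, hL3, hexpL, hLx, hL3ℓ⟩ := scales hx
  set ℓ : ℝ := Real.log x with hℓdef
  set L : ℝ := Real.log ℓ with hLdef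
  set L₃ : ℝ := Real.log L with hL3def
  have he2 : (2 : ℝ) < Real.exp 2 := by
    have := Real.add_one_le_exp (2 : ℝ); linarith
  have hℓ0 : 0 < ℓ := by linarith
  have hL0 : 0 < L := by linarith
  have hx0 : (0 : ℝ) < x := by
    have hee : 0 < Real.exp (Real.exp 2) := Real.exp_pos _
    linarith
  have hx2 : 2 ≤ x := by
    have h : (2 : ℝ) ≤ x := by linarith
    exact_mod_cast h
  have ht0 : 0 ≤ t := by linarith
  have ht1 : 0 ≤ t - 1 := by linarith
  -- the two Mertens inputs
  have hSx : ∑ p ∈ Nat.primesLE x, (1 : ℝ) / p ≤ L + 4 :=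
    Literature.NumberTheory.LFunctions.MertensBound.sum_inv_prime_le x hx2
  have hSy : Real.log L₃ - 10 ≤ ∑ p ∈ (Ioc ⌊(2 : ℝ)⌋₊ ⌊L⌋₊).filter Nat.Prime, (1 : ℝ) / p := by
    have h := Literature.NumberTheory.LFunctions.MertensBound.loglog_sub_loglog_le_sum_inv_prime
      (P := 2) (Q := L) le_rfl hL
    obtain ⟨h1, h2⟩ := loglog_two_bounds
    have : Real.log (Real.log L) = Real.log L₃ := rfl
    linarith
  -- rewrite the product as `exp` of a sum and bound the sum
  rw [← Real.exp_sum]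
  set a : ℕ → ℝ := fun p => if L < (p : ℝ) then t else 1 with ha
  have ha_le : ∀ p : ℕ, a p ≤ t := by
    intro p; simp only [ha]; split_ifs <;> linarith
  have ha_ge : ∀ p : ℕ, 1 ≤ a p := by
    intro p; simp only [ha]; split_ifs <;> linarith
  -- (i) the linear part: `a_p/p = t/p − (t−1)·[p ≤ L]/p`
  have hlin : ∑ p ∈ Nat.primesLE x, a p / p =
      t * ∑ p ∈ Nat.primesLE x, (1 : ℝ) / p -
        (t - 1) * ∑ p ∈ Nat.primesLE x, (if L < (p : ℝ) then 0 else 1) / (p : ℝ) := by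
    rw [Finset.mul_sum, Finset.mul_sum, ← Finset.sum_sub_distrib]
    refine Finset.sum_congr rfl fun p _ => ?_
    simp only [ha]
    split_ifs <;> ring
  have hSy' : Real.log L₃ - 10 ≤ ∑ p ∈ Nat.primesLE x, (if L < (p : ℝ) then 0 else 1) / (p : ℝ) := by
    rw [← Finset.sum_filter_add_sum_filter_not (Nat.primesLE x) (fun p : ℕ => L < (p : ℝ))]
    have hzero : ∑ p ∈ (Nat.primesLE x).filter (fun p : ℕ => L < (p : ℝ)),
        (if L < (p : ℝ) then (0 : ℝ) else 1) / (p : ℝ) = 0 := by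
      refine Finset.sum_eq_zero fun p hp => ?_
      rw [Finset.mem_filter] at hp
      rw [if_pos hp.2, zero_div]
    have hone : ∑ p ∈ (Nat.primesLE x).filter (fun p : ℕ => ¬ L < (p : ℝ)),
        (if L < (p : ℝ) then (0 : ℝ) else 1) / (p : ℝ) =
        ∑ p ∈ (Nat.primesLE x).filter (fun p : ℕ => ¬ L < (p : ℝ)), (1 : ℝ) / p := by
      refine Finset.sum_congr rfl fun p hp => ?_
      rw [Finset.mem_filter] at hp
      rw [if_neg hp.2]
    rw [hzero, zero_add, hone]
    refine hSy.trans (Finset.sum_le_sum_of_subset_of_nonneg ?_ fun p _ _ => by positivity)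
    intro p hp
    rw [Finset.mem_filter, Finset.mem_Ioc] at hp
    obtain ⟨⟨_, hpL⟩, hpp⟩ := hp
    have hpL' : (p : ℝ) ≤ L := by
      have := Nat.floor_le hL0.le
      have h' : (p : ℝ) ≤ ⌊L⌋₊ := by exact_mod_cast hpL
      linarith
    refine Finset.mem_filter.mpr ⟨Nat.mem_primesLE.mpr ⟨?_, hpp⟩, not_lt.mpr hpL'⟩
    have : (p : ℝ) ≤ x := hpL'.trans hLx
    exact_mod_cast this
  -- (ii) the quadratic part: `2a_p²/p² ≤ 2/p² + 2t²·[L < p]/p²`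
  have hquad : ∑ p ∈ Nat.primesLE x, 2 * a p ^ 2 / (p : ℝ) ^ 2 ≤ 2 + 14 * t := by
    have hsplit : ∀ p ∈ Nat.primesLE x, 2 * a p ^ 2 / (p : ℝ) ^ 2 ≤
        2 * ((p : ℝ) ^ 2)⁻¹ + 2 * t ^ 2 * (if L < (p : ℝ) then ((p : ℝ) ^ 2)⁻¹ else 0) := by
      intro p hp
      have hp' := Nat.prime_of_mem_primesLE hp
      have hp0 : (0 : ℝ) < (p : ℝ) ^ 2 := by
        have : (0 : ℝ) < p := by exact_mod_cast hp'.pos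
        positivity
      simp only [ha]
      split_ifs
      · rw [div_eq_mul_inv]; nlinarith [inv_pos.mpr hp0]
      · rw [div_eq_mul_inv]; nlinarith [inv_pos.mpr hp0, sq_nonneg t]
    refine (Finset.sum_le_sum hsplit).trans ?_
    rw [Finset.sum_add_distrib, ← Finset.mul_sum, ← Finset.mul_sum, ← Finset.sum_filter]
    -- `Σ_{p ≤ x} 1/p² ≤ 1` and `Σ_{L < p ≤ x} 1/p² ≤ 2/L`
    have h1 : ∑ p ∈ Nat.primesLE x, ((p : ℝ) ^ 2)⁻¹ ≤ 1 := by
      have hsub : Nat.primesLE x ⊆ Ioo 1 (x + 1) := by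
        intro p hp
        rw [Nat.mem_primesLE] at hp
        rw [Finset.mem_Ioo]
        exact ⟨hp.2.one_lt, Nat.lt_succ_of_le hp.1⟩
      calc ∑ p ∈ Nat.primesLE x, ((p : ℝ) ^ 2)⁻¹ ≤ ∑ i ∈ Ioo 1 (x + 1), ((i : ℝ) ^ 2)⁻¹ :=
            Finset.sum_le_sum_of_subset_of_nonneg hsub fun i _ _ => by positivity
        _ ≤ 2 / ((1 : ℕ) + 1) := sum_Ioo_inv_sq_le 1 (x + 1)
        _ = 1 := by norm_num
    have h2 : ∑ p ∈ (Nat.primesLE x).filter (fun p : ℕ => L < (p : ℝ)), ((p : ℝ) ^ 2)⁻¹ ≤ 2 / L := by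
      have hsub : (Nat.primesLE x).filter (fun p : ℕ => L < (p : ℝ)) ⊆ Ioo ⌊L⌋₊ (x + 1) := by
        intro p hp
        rw [Finset.mem_filter, Nat.mem_primesLE] at hp
        rw [Finset.mem_Ioo]
        exact ⟨(Nat.floor_lt hL0.le).mpr hp.2, Nat.lt_succ_of_le hp.1.1⟩
      calc ∑ p ∈ (Nat.primesLE x).filter (fun p : ℕ => L < (p : ℝ)), ((p : ℝ) ^ 2)⁻¹
          ≤ ∑ i ∈ Ioo ⌊L⌋₊ (x + 1), ((i : ℝ) ^ 2)⁻¹ :=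
            Finset.sum_le_sum_of_subset_of_nonneg hsub fun i _ _ => by positivity
        _ ≤ 2 / ((⌊L⌋₊ : ℕ) + 1) := sum_Ioo_inv_sq_le ⌊L⌋₊ (x + 1)
        _ ≤ 2 / L := by
            refine div_le_div_of_nonneg_left (by norm_num) hL0 ?_
            exact (Nat.lt_floor_add_one L).le
    have h3 : 2 * t ^ 2 * (2 / L) ≤ 14 * t := by
      -- `4 t² ≤ 14 t L` since `4t ≤ 4 + 12 L ≤ 14 L`
      rw [show 2 * t ^ 2 * (2 / L) = (4 * t * t) / L by ring, div_le_iff₀ hL0]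
      nlinarith
    nlinarith [h1, h2, h3, sq_nonneg t]
  -- assemble the exponent
  have hexp : ∑ p ∈ Nat.primesLE x, (a p / p + 2 * a p ^ 2 / (p : ℝ) ^ 2) ≤
      t * L - (t - 1) * Real.log L₃ + 28 * t + 2 := by
    rw [Finset.sum_add_distrib, hlin]
    have h1 : t * ∑ p ∈ Nat.primesLE x, (1 : ℝ) / p ≤ t * (L + 4) := mul_le_mul_of_nonneg_left hSx ht0
    have h2 : (t - 1) * (Real.log L₃ - 10) ≤
        (t - 1) * ∑ p ∈ Nat.primesLE x, (if L < (p : ℝ) then 0 else 1) / (p : ℝ) :=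
      mul_le_mul_of_nonneg_left hSy' ht1
    nlinarith [hquad]
  -- turn it into the claimed shape
  have hU0 : 0 < ℓ / L₃ := div_pos hℓ0 hL3
  have hrpow : (ℓ / L₃) ^ (t - 1) = Real.exp ((t - 1) * (L - Real.log L₃)) := by
    rw [Real.rpow_def_of_pos hU0, Real.log_div hℓ0.ne' hL3.ne', ← hLdef]
    congr 1
    ring
  have hxℓ : (x : ℝ) / ℓ = x * Real.exp (-L) := by
    rw [Real.exp_neg, hexpL, div_eq_mul_inv]
  rw [hxℓ, hrpow, mul_assoc, mul_assoc, ← Real.exp_add, ← Real.exp_add]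
  refine mul_le_mul_of_nonneg_left (Real.exp_le_exp.mpr ?_) hx0.le
  linarith [hexp]

/-- **Real-axis rough moment for the integers (sharp exponent).**  For natural `x ≥ exp(exp 2)` and
real `1 ≤ t ≤ 1 + 3 log log x`:
`Σ_{0 ≤ n ≤ x} t^{s♯_x(n)} ≤ A₀ · x · U^{t−1} · exp(30 t)`, where `s♯_x(n) = Σ_{p^v ∥ n, p > log log x} min(v,2)`,
`U = log x / log log log x` and `A₀ = (log 4 + B₁ + 1)e² + 1` (`B₁` the Hall–Tenenbaum constant).  This is the
`z = t` real, `k = 1`, `f = (X)` slice of the rough majorant S6 of the line (there `((X).eval n).toNat = n`). -/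
theorem stub_roughMomentLinearReal :
    ∀ x : ℕ, Real.exp (Real.exp 2) ≤ x → ∀ t : ℝ, 1 ≤ t → t ≤ 1 + 3 * Real.log (Real.log x) →
      (∑ n ∈ Finset.range (x + 1),
          t ^ (n.factorization.sum fun p v => if Real.log (Real.log x) < (p : ℝ) then min v 2 else 0)) ≤
        ((Real.log 4 + Literature.NumberTheory.LFunctions.HallTenenbaum.B₁ + 1) * Real.exp 2 + 1) *
          x * (Real.log x / Real.log (Real.log (Real.log x))) ^ (t - 1) * Real.exp (30 * t) := by
  intro x hx t ht htL
  obtain ⟨hℓ, hL, hL3, -, -, hL3ℓ⟩ := scales hx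
  set B := Literature.NumberTheory.LFunctions.HallTenenbaum.B₁ with hB
  have hB0 : 0 ≤ B := Literature.NumberTheory.LFunctions.HallTenenbaum.B₁_nonneg
  have hlog4 : 0 ≤ Real.log 4 := Real.log_nonneg (by norm_num)
  have he2 : (2 : ℝ) < Real.exp 2 := by
    have := Real.add_one_le_exp (2 : ℝ); linarith
  have hℓ0 : 0 < Real.log x := by linarith
  have hx1 : (1 : ℝ) ≤ x := by
    have hee : Real.exp 2 < Real.exp (Real.exp 2) := Real.exp_lt_exp.mpr he2
    linarith
  have hx2 : 2 ≤ x := by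
    have hee : Real.exp 2 < Real.exp (Real.exp 2) := Real.exp_lt_exp.mpr he2
    have h : (2 : ℝ) ≤ x := by linarith
    exact_mod_cast h
  have ht0 : 0 ≤ t := by linarith
  set U : ℝ := Real.log x / Real.log (Real.log (Real.log x)) with hU
  have hU1 : 1 ≤ U := by rw [hU, le_div_iff₀ hL3, one_mul]; exact hL3ℓ
  have hUt : 1 ≤ U ^ (t - 1) := Real.one_le_rpow hU1 (by linarith)
  -- the `n = 0` term and the main sum
  rw [Finset.sum_range_eq_add_Ico _ (by omega : 0 < x + 1), Finset.Ico_add_one_right_eq_Icc]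
  simp only [Nat.factorization_zero, Finsupp.sum_zero_index, pow_zero]
  have hcoef0 : 0 ≤ t * Real.log 4 + t ^ 2 * B + 1 := by positivity
  have h1 := stub_sumRoughLeProd (Real.log (Real.log x)) x hx2 t ht
  rw [mul_assoc] at h1
  have hmain := h1.trans (mul_le_mul_of_nonneg_left (prod_exp_le hx ht htL) hcoef0)
  -- `t log 4 + t² B + 1 ≤ (log 4 + B + 1) e^{2t}` and `e^{2t} e^{28t+2} = e² e^{30t}`
  have het : t ≤ Real.exp t := by have := Real.add_one_le_exp t; linarith
  have het2 : t ^ 2 ≤ Real.exp (2 * t) := by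
    rw [show Real.exp (2 * t) = Real.exp t ^ 2 by rw [← Real.exp_nat_mul]; norm_num]
    exact pow_le_pow_left₀ ht0 het 2
  have he1 : 1 ≤ Real.exp (2 * t) := Real.one_le_exp (by linarith)
  have hcoef : t * Real.log 4 + t ^ 2 * B + 1 ≤ (Real.log 4 + B + 1) * Real.exp (2 * t) := by
    have h1 : t ≤ Real.exp (2 * t) := het.trans (Real.exp_le_exp.mpr (by linarith))
    nlinarith
  have hexp : Real.exp (2 * t) * Real.exp (28 * t + 2) = Real.exp 2 * Real.exp (30 * t) := by
    rw [← Real.exp_add, ← Real.exp_add]; ring_nf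
  have hX : 0 ≤ (x : ℝ) * U ^ (t - 1) * Real.exp (28 * t + 2) := by positivity
  calc 1 + ∑ n ∈ Icc 1 x,
        t ^ (n.factorization.sum fun p v => if Real.log (Real.log x) < (p : ℝ) then min v 2 else 0)
      ≤ 1 + (t * Real.log 4 + t ^ 2 * B + 1) * ((x : ℝ) * U ^ (t - 1) * Real.exp (28 * t + 2)) := by
        linarith [hmain]
    _ ≤ (x : ℝ) * U ^ (t - 1) * Real.exp (30 * t) +
        (Real.log 4 + B + 1) * Real.exp (2 * t) * ((x : ℝ) * U ^ (t - 1) * Real.exp (28 * t + 2)) := by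
        have h1 : (1 : ℝ) ≤ (x : ℝ) * U ^ (t - 1) * Real.exp (30 * t) := by
          have := Real.one_le_exp (show 0 ≤ 30 * t by linarith)
          calc (1 : ℝ) = 1 * 1 * 1 := by ring
            _ ≤ (x : ℝ) * U ^ (t - 1) * Real.exp (30 * t) := by gcongr
        have h2 := mul_le_mul_of_nonneg_right hcoef hX
        linarith
    _ = ((Real.log 4 + B + 1) * Real.exp 2 + 1) * x * U ^ (t - 1) * Real.exp (30 * t) := by
        have : (Real.log 4 + B + 1) * Real.exp (2 * t) * ((x : ℝ) * U ^ (t - 1) * Real.exp (28 * t + 2)) =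
            (Real.log 4 + B + 1) * Real.exp 2 * x * U ^ (t - 1) * Real.exp (30 * t) := by
          calc (Real.log 4 + B + 1) * Real.exp (2 * t) * ((x : ℝ) * U ^ (t - 1) * Real.exp (28 * t + 2))
              = (Real.log 4 + B + 1) * x * U ^ (t - 1) * (Real.exp (2 * t) * Real.exp (28 * t + 2)) := by ring
            _ = _ := by rw [hexp]; ring
        rw [this]; ring

/-- **The `k = 1`, `f = (X)`, real-`z` slice of S6 `stub_roughMajorant`.**  For the linear system `![X]` and real
`z = t ≥ 1` on the disc `‖z − 1‖ ≤ 3 log log x`, the rough majorant inequality of S6 holds: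
`‖Σ_{m₀≤n≤x} z^{s♯_x(n)}‖ ≤ A·x·U^{1·(Re z−1)}·exp(C‖z−1‖log(‖z−1‖+2))` with `A = A₀e^{30}`, `C = 30/log 2`,
`x₀ = ⌈exp(exp 2)⌉₊` (the body is VERBATIM that of `stub_roughMajorant` at `k := 1`, `f := ![X]`, plus the two
hypotheses `z.im = 0`, `1 ≤ z.re`).  The complementary directions (`Re z < 1`, `Im z ≠ 0`) are the parity content. -/
theorem stub_roughMajorantLinearRealAxis :
    ∀ m₀ : ℕ, ∃ A C : ℝ, ∃ x₀ : ℕ, ∀ x : ℕ, x₀ ≤ x → ∀ z : ℂ, ‖z - 1‖ ≤ 3 * Real.log (Real.log (x : ℝ)) →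
      z.im = 0 → 1 ≤ z.re →
        ‖(∑ n ∈ Finset.Ico m₀ (x + 1), (z : ℂ) ^ (∑ i, (((![(Polynomial.X : Polynomial ℤ)] i).eval (n : ℤ)).toNat.factorization.sum
            fun p v => if Real.log (Real.log (x : ℝ)) < (p : ℝ) then min v 2 else 0)))‖ ≤
          A * (x : ℝ) * (Real.log (x : ℝ) / Real.log (Real.log (Real.log (x : ℝ)))) ^ (((1 : ℕ) : ℝ) * (z.re - 1)) *
            Real.exp (C * ‖(z : ℂ) - 1‖ * Real.log (‖(z : ℂ) - 1‖ + 2)) := by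
  intro m₀
  set A₀ : ℝ := (Real.log 4 + Literature.NumberTheory.LFunctions.HallTenenbaum.B₁ + 1) * Real.exp 2 + 1 with hA₀
  have hA₀0 : 0 ≤ A₀ := by
    have := Literature.NumberTheory.LFunctions.HallTenenbaum.B₁_nonneg
    have hlog4 : 0 ≤ Real.log 4 := Real.log_nonneg (by norm_num)
    positivity
  refine ⟨A₀ * Real.exp 30, 30 / Real.log 2, ⌈Real.exp (Real.exp 2)⌉₊, ?_⟩
  intro x hx z hz hzim hzre
  have hx' : Real.exp (Real.exp 2) ≤ x := (Nat.le_ceil _).trans (by exact_mod_cast hx)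
  set t : ℝ := z.re with ht
  have hzt : z = (t : ℂ) := Complex.ext (by simp [ht]) (by simp [hzim])
  have hnorm : ‖z - 1‖ = t - 1 := by
    rw [hzt, show ((t : ℂ) - 1) = ((t - 1 : ℝ) : ℂ) by push_cast; ring, Complex.norm_real,
      Real.norm_eq_abs, abs_of_nonneg (by linarith)]
  have htL : t ≤ 1 + 3 * Real.log (Real.log (x : ℝ)) := by rw [hnorm] at hz; linarith
  -- the sum is the real rough moment of the integers, restricted to `Ico m₀ (x+1)`
  have hterm : ∀ n : ℕ, (z : ℂ) ^ (∑ i, (((![(Polynomial.X : Polynomial ℤ)] i).eval (n : ℤ)).toNat.factorization.sum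
      fun p v => if Real.log (Real.log (x : ℝ)) < (p : ℝ) then min v 2 else 0)) =
      ((t ^ (n.factorization.sum fun p v => if Real.log (Real.log (x : ℝ)) < (p : ℝ) then min v 2 else 0) : ℝ) : ℂ) := by
    intro n
    rw [hzt, Complex.ofReal_pow]
    congr 1
    simp
  have hsum : (∑ n ∈ Finset.Ico m₀ (x + 1), (z : ℂ) ^ (∑ i, (((![(Polynomial.X : Polynomial ℤ)] i).eval (n : ℤ)).toNat.factorization.sum
      fun p v => if Real.log (Real.log (x : ℝ)) < (p : ℝ) then min v 2 else 0))) =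
      ((∑ n ∈ Finset.Ico m₀ (x + 1),
        t ^ (n.factorization.sum fun p v => if Real.log (Real.log (x : ℝ)) < (p : ℝ) then min v 2 else 0) : ℝ) : ℂ) := by
    rw [Complex.ofReal_sum]
    exact Finset.sum_congr rfl fun n _ => hterm n
  have ht0 : 0 ≤ t := by linarith
  have hnn : ∀ n : ℕ, 0 ≤ t ^ (n.factorization.sum fun p v => if Real.log (Real.log (x : ℝ)) < (p : ℝ) then min v 2 else 0) :=
    fun n => pow_nonneg ht0 _
  have hreal : ‖(∑ n ∈ Finset.Ico m₀ (x + 1), (z : ℂ) ^ (∑ i, (((![(Polynomial.X : Polynomial ℤ)] i).eval (n : ℤ)).toNat.factorization.sum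
      fun p v => if Real.log (Real.log (x : ℝ)) < (p : ℝ) then min v 2 else 0)))‖ ≤
      ∑ n ∈ Finset.range (x + 1),
        t ^ (n.factorization.sum fun p v => if Real.log (Real.log (x : ℝ)) < (p : ℝ) then min v 2 else 0) := by
    rw [hsum, Complex.norm_real, Real.norm_eq_abs, abs_of_nonneg (Finset.sum_nonneg fun n _ => hnn n)]
    refine Finset.sum_le_sum_of_subset_of_nonneg ?_ fun n _ _ => hnn n
    intro n hn
    rw [Finset.mem_Ico] at hn
    exact Finset.mem_range.mpr hn.2
  have hmom := stub_roughMomentLinearReal x hx' t hzre htL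
  -- reshape the right-hand side
  have hexp1 : ((1 : ℕ) : ℝ) * (z.re - 1) = t - 1 := by push_cast; rw [ht]; ring
  rw [hexp1, hnorm]
  have hU : 0 ≤ (Real.log (x : ℝ) / Real.log (Real.log (Real.log (x : ℝ)))) ^ (t - 1) := by
    obtain ⟨hℓ, -, hL3, -⟩ := scales hx'
    have : 0 ≤ Real.log (x : ℝ) := by
      have := Real.exp_pos 2; linarith
    exact Real.rpow_nonneg (div_nonneg this hL3.le) _
  have hC : Real.exp (30 * t) ≤ Real.exp 30 * Real.exp (30 / Real.log 2 * (t - 1) * Real.log (t - 1 + 2)) := by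
    rw [← Real.exp_add]
    refine Real.exp_le_exp.mpr ?_
    have hlog2 : 0 < Real.log 2 := Real.log_pos one_lt_two
    have hlt : Real.log 2 ≤ Real.log (t - 1 + 2) := Real.log_le_log two_pos (by linarith)
    have ht1 : 0 ≤ t - 1 := by linarith
    have h1 : 30 * (t - 1) * Real.log 2 ≤ 30 * (t - 1) * Real.log (t - 1 + 2) :=
      mul_le_mul_of_nonneg_left hlt (by positivity)
    have h2 : 30 / Real.log 2 * (t - 1) * Real.log (t - 1 + 2) = (30 * (t - 1) * Real.log (t - 1 + 2)) / Real.log 2 := by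
      ring
    rw [h2]
    have h3 : 30 * (t - 1) ≤ 30 * (t - 1) * Real.log (t - 1 + 2) / Real.log 2 := by
      rw [le_div_iff₀ hlog2]; linarith [h1]
    linarith
  calc _ ≤ ∑ n ∈ Finset.range (x + 1),
        t ^ (n.factorization.sum fun p v => if Real.log (Real.log (x : ℝ)) < (p : ℝ) then min v 2 else 0) := hreal
    _ ≤ A₀ * x * (Real.log (x : ℝ) / Real.log (Real.log (Real.log (x : ℝ)))) ^ (t - 1) * Real.exp (30 * t) := hmom
    _ ≤ A₀ * x * (Real.log (x : ℝ) / Real.log (Real.log (Real.log (x : ℝ)))) ^ (t - 1) *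
        (Real.exp 30 * Real.exp (30 / Real.log 2 * (t - 1) * Real.log (t - 1 + 2))) :=
        mul_le_mul_of_nonneg_left hC (by positivity)
    _ = A₀ * Real.exp 30 * x * (Real.log (x : ℝ) / Real.log (Real.log (Real.log (x : ℝ)))) ^ (t - 1) *
        Real.exp (30 / Real.log 2 * (t - 1) * Real.log (t - 1 + 2)) := by ring

end Summit.Parity.BatemanHorn.Cruxes.SystemZeroRepulsion.SmoothRoughLatticeAcquisition

end
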